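import Literature.Probability.RandomPlanarGeometry.WholePlaneInvMapMeasurable
import Literature.Probability.RandomPlanarGeometry.WholePlaneCurveAssembly
import Mathlib.MeasureTheory.Constructions.Polish.Basic
import HarnessLib

/-!
# Measurability of the whole-plane SLE_κ(ρ) curve in the angle path and the phase

Topic `Probability/RandomPlanarGeometry`; definitions with bodies (`goodAnglePaths`, `approachSeq`,
`WholePlaneLoewner.tipSeq`, `wpCurve`) and proved theorems (no named fact). Sequel of
`WholePlaneInvMapMeasurable` (measurability of the whole-plane inverse maps in a parameter) and
`WholePlaneCurveAssembly` (the tip path `WholePlaneLoewner.tip`). On the product of the two-sided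
angle path space `C(ℝ, ℝ)` (Borel σ-algebra of the compact-open topology, scoped instances
`PathBorel`) and the phase line `ℝ`, the map `(X, q₀) ↦ γ(t)` — the whole-plane curve of the
driving angle `λ = drivingOfAngle q₀ X` at time `t` — is Borel measurable (the measurability
clause of `IsWholePlaneSLEKappaRho`):

* `goodAnglePaths` — the Borel set of angle paths staying in `(0, 2π)` (`mem_goodAnglePaths_iff`);
* `eventually_abs_drivingOfAngle_sub_le` — on it, `(X, q₀) ↦ λ` is continuous locally uniformly in
  time (the drift integrand `cot(X/2)` is Lipschitz on the compact ranges of `X`);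
* `measurable_invMap_drivingOfAngle` — `(X, q₀) ↦ F_t^{λ}(R e^{iλ_t})` (extended by `0`) is
  measurable (`measurable_invMap_param` on the good subtype);
* `WholePlaneLoewner.tipSeq`, `wpCurve` — the tip along the sequence `R_k = 1 + 1/(k+1) ↓ 1`
  (equal to `WholePlaneLoewner.tip` whenever the tip limit exists, `tipSeq_eq_of_tendsto`) and the
  resulting curve `wpCurve (X, q₀) t`, with `measurable_wpCurve`.

## References

* S. Rohde, O. Schramm, *Basic properties of SLE*, Ann. of Math. 161 (2005), §3. [RohdeSchramm2005]
* J. Miller, S. Sheffield, *Imaginary geometry IV*, PTRF 169 (2017), Prop. 2.5. [MillerSheffield2013]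
-/

noncomputable section

open Set Filter Topology Metric Complex MeasureTheory
open scoped NNReal Real

namespace Literature.Probability.RandomPlanarGeometry

open scoped PathBorel
open WholePlaneLoewner.BackwardFlow

/-! ### The good set of angle paths -/

/-- The **good angle paths**: on every compact time interval the path keeps a margin from
`{0, 2π}`; equivalently (`mem_goodAnglePaths_iff`) it stays in `(0, 2π)` at all times. Written with
closed pointwise conditions so that it is visibly Borel. [folklore] -/
def goodAnglePaths : Set C(ℝ, ℝ) :=
  {x | ∀ N : ℕ, ∃ m : ℕ, ∀ s ∈ Icc (-(N : ℝ)) N, x s ∈ Icc (1 / ((m : ℝ) + 1)) (2 * π - 1 / ((m : ℝ) + 1))}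

/-- The good set is Borel. [folklore] -/
theorem measurableSet_goodAnglePaths : MeasurableSet goodAnglePaths := by
  have h : goodAnglePaths = ⋂ N : ℕ, ⋃ m : ℕ, {x : C(ℝ, ℝ) | ∀ s ∈ Icc (-(N : ℝ)) N,
      x s ∈ Icc (1 / ((m : ℝ) + 1)) (2 * π - 1 / ((m : ℝ) + 1))} := by
    ext x; simp only [goodAnglePaths, mem_setOf_eq, mem_iInter, mem_iUnion]
  rw [h]
  refine MeasurableSet.iInter fun N ↦ MeasurableSet.iUnion fun m ↦ IsClosed.measurableSet ?_
  have : {x : C(ℝ, ℝ) | ∀ s ∈ Icc (-(N : ℝ)) N, x s ∈ Icc (1 / ((m : ℝ) + 1)) (2 * π - 1 / ((m : ℝ) + 1))} =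
      ⋂ s ∈ Icc (-(N : ℝ)) N, (fun x : C(ℝ, ℝ) ↦ x s) ⁻¹' Icc (1 / ((m : ℝ) + 1)) (2 * π - 1 / ((m : ℝ) + 1)) := by
    ext x; simp
  rw [this]
  exact isClosed_biInter fun s _ ↦ isClosed_Icc.preimage (continuous_eval_const s)

/-- **The good set is the set of paths staying in `(0, 2π)`.** [folklore] -/
theorem mem_goodAnglePaths_iff {x : C(ℝ, ℝ)} : x ∈ goodAnglePaths ↔ ∀ t, x t ∈ Ioo 0 (2 * π) := by
  constructor
  · intro h t
    obtain ⟨N, hN⟩ := exists_nat_ge |t|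
    obtain ⟨m, hm⟩ := h N
    have ht : t ∈ Icc (-(N : ℝ)) N := ⟨by linarith [neg_abs_le t], (le_abs_self t).trans hN⟩
    have := hm t ht
    have hpos : (0 : ℝ) < 1 / ((m : ℝ) + 1) := by positivity
    exact ⟨by linarith [this.1], by linarith [this.2]⟩
  · intro h N
    have hK : IsCompact (Icc (-(N : ℝ)) N) := isCompact_Icc
    have hne : (Icc (-(N : ℝ)) N).Nonempty := ⟨0, by simp⟩
    obtain ⟨s₁, hs₁, hmin⟩ := hK.exists_isMinOn hne x.continuous.continuousOn
    obtain ⟨s₂, hs₂, hmax⟩ := hK.exists_isMaxOn hne x.continuous.continuousOn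
    have h1 : 0 < x s₁ := (h s₁).1
    have h2 : x s₂ < 2 * π := (h s₂).2
    obtain ⟨m, hm⟩ := exists_nat_one_div_lt (lt_min h1 (show 0 < 2 * π - x s₂ by linarith))
    refine ⟨m, fun s hs ↦ ⟨?_, ?_⟩⟩
    · have := hmin hs; simp only [mem_setOf_eq] at this
      have hlt := hm.trans_le (min_le_left _ _)
      linarith
    · have := hmax hs; simp only [mem_setOf_eq] at this
      have hlt := hm.trans_le (min_le_right _ _)
      linarith

/-- A good path stays in `(0, 2π)`. [folklore] -/
theorem forall_mem_Ioo_of_mem_goodAnglePaths {x : C(ℝ, ℝ)} (hx : x ∈ goodAnglePaths) (t : ℝ) :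
    x t ∈ Ioo 0 (2 * π) := mem_goodAnglePaths_iff.1 hx t

/-! ### The drift integrand is Lipschitz on compact ranges -/

/-- `sin (ε/2) ≤ sin (y/2)` for `y ∈ [ε, 2π - ε]`, `0 < ε ≤ π`. [folklore] -/
theorem sin_half_ge {ε y : ℝ} (hε : 0 < ε) (hεπ : ε ≤ π) (hy : y ∈ Icc ε (2 * π - ε)) :
    Real.sin (ε / 2) ≤ Real.sin (y / 2) := by
  rcases le_or_gt (y / 2) (π / 2) with h | h
  · exact Real.sin_le_sin_of_le_of_le_pi_div_two (by linarith) h (by linarith [hy.1])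
  · rw [← Real.sin_pi_sub (y / 2)]
    exact Real.sin_le_sin_of_le_of_le_pi_div_two (by linarith) (by linarith) (by linarith [hy.2])

/-- **`y ↦ cot(y/2)` is Lipschitz on `[ε, 2π - ε]`**: `|cot(y/2) - cot(y'/2)| ≤ |y - y'|/(2 sin²(ε/2))`
(`cot a - cot b = sin(b - a)/(sin a sin b)`). [folklore] -/
theorem abs_cot_half_sub_le {ε y y' : ℝ} (hε : 0 < ε) (hεπ : ε ≤ π) (hy : y ∈ Icc ε (2 * π - ε))
    (hy' : y' ∈ Icc ε (2 * π - ε)) :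
    |Real.cot (y / 2) - Real.cot (y' / 2)| ≤ |y - y'| / (2 * Real.sin (ε / 2) ^ 2) := by
  have hσ : 0 < Real.sin (ε / 2) := Real.sin_pos_of_pos_of_lt_pi (by linarith) (by linarith)
  have hsy : Real.sin (ε / 2) ≤ Real.sin (y / 2) := sin_half_ge hε hεπ hy
  have hsy' : Real.sin (ε / 2) ≤ Real.sin (y' / 2) := sin_half_ge hε hεπ hy'
  have hy0 : 0 < Real.sin (y / 2) := hσ.trans_le hsy
  have hy'0 : 0 < Real.sin (y' / 2) := hσ.trans_le hsy'
  have hid : Real.cot (y / 2) - Real.cot (y' / 2) = Real.sin (y' / 2 - y / 2) / (Real.sin (y / 2) * Real.sin (y' / 2)) := by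
    rw [Real.cot_eq_cos_div_sin, Real.cot_eq_cos_div_sin, div_sub_div _ _ hy0.ne' hy'0.ne', Real.sin_sub]
    congr 1; ring
  rw [hid, abs_div, abs_of_pos (mul_pos hy0 hy'0)]
  have h1 : |Real.sin (y' / 2 - y / 2)| ≤ |y - y'| / 2 := by
    refine Real.abs_sin_le_abs.trans ?_
    rw [show y' / 2 - y / 2 = -((y - y') / 2) by ring, abs_neg, abs_div, abs_two]
  rw [div_le_div_iff₀ (mul_pos hy0 hy'0) (by positivity)]
  calc |Real.sin (y' / 2 - y / 2)| * (2 * Real.sin (ε / 2) ^ 2)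
      ≤ |y - y'| / 2 * (2 * (Real.sin (y / 2) * Real.sin (y' / 2))) := by
        refine mul_le_mul h1 ?_ (by positivity) (by positivity)
        rw [sq]
        exact mul_le_mul_of_nonneg_left (mul_le_mul hsy hsy' hσ.le hy0.le) (by norm_num)
    _ = |y - y'| * (Real.sin (y / 2) * Real.sin (y' / 2)) := by ring

/-! ### The driving angle depends continuously on `(X, q₀)`, locally uniformly in time -/

/-- The good parameter subtype: good angle path and phase. [folklore] -/
abbrev GoodParam : Type := {p : C(ℝ, ℝ) × ℝ // p.1 ∈ goodAnglePaths}

/-- The driving angle of a good parameter. [folklore] -/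
def goodDriving (p : GoodParam) : ℝ → ℝ := drivingOfAngle p.1.2 p.1.1

/-- The driving angle of a good parameter is continuous. [folklore] -/
theorem continuous_goodDriving (p : GoodParam) : Continuous (goodDriving p) :=
  continuous_drivingOfAngle _ _ (forall_mem_Ioo_of_mem_goodAnglePaths p.2)

/-- Nearby paths are uniformly close on compact time intervals (compact-open topology).
[folklore] -/
theorem eventually_forall_dist_lt (x₀ : C(ℝ, ℝ)) {K : Set ℝ} (hK : IsCompact K) {r : ℝ} (hr : 0 < r) :
    ∀ᶠ x in 𝓝 x₀, ∀ s ∈ K, dist (x₀ s) (x s) < r := by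
  have h := (ContinuousMap.tendsto_iff_forall_isCompact_tendstoUniformlyOn.1
    (tendsto_id (x := 𝓝 x₀))) K hK
  exact (Metric.tendstoUniformlyOn_iff.1 h) r hr

/-- **Local uniform continuity of the driving angle in the good parameter**: for every time window
`[a, b]`, `sup_{[a,b]} |λ(p) - λ(p₀)| → 0` as `p → p₀`. [folklore] -/
theorem eventually_abs_goodDriving_sub_le (a b : ℝ) (p₀ : GoodParam) (ε : ℝ) (hε : 0 < ε) :
    ∀ᶠ p in 𝓝 p₀, ∀ s ∈ Icc a b, |goodDriving p s - goodDriving p₀ s| ≤ ε := by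
  obtain ⟨⟨x₀, q₀⟩, hx₀⟩ := p₀
  -- a compact time interval `[-N, N] ⊇ [a, b] ∪ {0}`
  obtain ⟨N, hN⟩ := exists_nat_ge (|a| + |b|)
  have hsub : ∀ s ∈ Icc a b, s ∈ Icc (-(N : ℝ)) N := fun s hs ↦
    ⟨by linarith [hs.1, neg_abs_le a, abs_nonneg b], by linarith [hs.2, le_abs_self b, abs_nonneg a]⟩
  have h0N : (0 : ℝ) ∈ Icc (-(N : ℝ)) N := ⟨by simp, N.cast_nonneg⟩
  -- the margin of `x₀` on `[-N, N]`
  obtain ⟨m, hm⟩ := (show x₀ ∈ goodAnglePaths from hx₀) N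
  set μ : ℝ := 1 / ((m : ℝ) + 1) with hμ
  have hμpos : 0 < μ := by rw [hμ]; positivity
  have hμle : μ ≤ 1 := by rw [hμ, div_le_one (by positivity)]; linarith [m.cast_nonneg (α := ℝ)]
  have hμπ : μ / 2 ≤ π := by linarith [Real.pi_gt_three]
  -- the Lipschitz constant of `cot(·/2)` on the half-margin band and the radius
  set Lc : ℝ := 1 / (2 * Real.sin (μ / 4) ^ 2) with hLc
  have hσ : 0 < Real.sin (μ / 4) := Real.sin_pos_of_pos_of_lt_pi (by positivity) (by linarith [Real.pi_gt_three])
  have hLcpos : 0 < Lc := by rw [hLc]; positivity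
  set r : ℝ := min (μ / 2) (ε / (3 * (N * Lc + 1))) with hr
  have hrpos : 0 < r := lt_min (by positivity) (by positivity)
  have hrμ : r ≤ μ / 2 := min_le_left _ _
  have hrε : r * (N * Lc + 1) ≤ ε / 3 := by
    have h1 : r ≤ ε / (3 * (N * Lc + 1)) := min_le_right _ _
    have h2 : 0 < N * Lc + 1 := by positivity
    calc r * (N * Lc + 1) ≤ ε / (3 * (N * Lc + 1)) * (N * Lc + 1) := mul_le_mul_of_nonneg_right h1 h2.le
      _ = ε / 3 := by field_simp
  -- the neighbourhood
  have h1 : ∀ᶠ p : GoodParam in 𝓝 ⟨(x₀, q₀), hx₀⟩, ∀ s ∈ Icc (-(N : ℝ)) N, dist (x₀ s) (p.1.1 s) < r := by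
    have hc : Continuous fun p : GoodParam ↦ p.1.1 := continuous_fst.comp continuous_subtype_val
    exact (hc.tendsto ⟨(x₀, q₀), hx₀⟩).eventually (eventually_forall_dist_lt x₀ isCompact_Icc hrpos)
  have h2 : ∀ᶠ p : GoodParam in 𝓝 ⟨(x₀, q₀), hx₀⟩, dist p.1.2 q₀ < ε / 3 := by
    have hc : Continuous fun p : GoodParam ↦ p.1.2 := continuous_snd.comp continuous_subtype_val
    have := Metric.tendsto_nhds.1 (hc.tendsto ⟨(x₀, q₀), hx₀⟩) (ε / 3) (by positivity)
    simpa using this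
  filter_upwards [h1, h2] with p hp1 hp2 s hs
  obtain ⟨⟨x, q⟩, hx⟩ := p
  simp only at hp1 hp2 ⊢
  have hxI := forall_mem_Ioo_of_mem_goodAnglePaths hx
  have hx₀I := forall_mem_Ioo_of_mem_goodAnglePaths hx₀
  -- both paths in the half-margin band on `[-N, N]`
  have hband₀ : ∀ u ∈ Icc (-(N : ℝ)) N, x₀ u ∈ Icc (μ / 2) (2 * π - μ / 2) := fun u hu ↦
    ⟨by linarith [(hm u hu).1], by linarith [(hm u hu).2]⟩
  have hband : ∀ u ∈ Icc (-(N : ℝ)) N, x u ∈ Icc (μ / 2) (2 * π - μ / 2) := by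
    intro u hu
    have hd := hp1 u hu
    rw [Real.dist_eq, abs_lt] at hd
    exact ⟨by linarith [(hm u hu).1], by linarith [(hm u hu).2]⟩
  -- pointwise bound of the integrands on `[-N, N]`
  have hcot : ∀ u ∈ Icc (-(N : ℝ)) N, |Real.cot (x u / 2) - Real.cot (x₀ u / 2)| ≤ Lc * r := by
    intro u hu
    have h := abs_cot_half_sub_le (ε := μ / 2) (by positivity) hμπ (hband u hu) (hband₀ u hu)
    rw [show μ / 2 / 2 = μ / 4 by ring] at h
    refine h.trans ?_
    rw [hLc, div_eq_mul_one_div, mul_comm]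
    refine mul_le_mul_of_nonneg_left ?_ (by positivity)
    have := hp1 u hu
    rw [Real.dist_eq, abs_sub_comm] at this
    exact this.le
  -- the integral bound
  have hsN := hsub s hs
  have hint : |(∫ u in (0 : ℝ)..s, Real.cot (x u / 2)) - ∫ u in (0 : ℝ)..s, Real.cot (x₀ u / 2)| ≤ Lc * r * N := by
    rw [← intervalIntegral.integral_sub ((continuous_cot_half_path x hxI).intervalIntegrable _ _)
      ((continuous_cot_half_path x₀ hx₀I).intervalIntegrable _ _)]
    have h := intervalIntegral.norm_integral_le_of_norm_le_const (a := 0) (b := s) (C := Lc * r)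
      (f := fun u ↦ Real.cot (x u / 2) - Real.cot (x₀ u / 2)) fun u hu ↦ by
        rw [Real.norm_eq_abs]
        refine hcot u ?_
        have hu' : u ∈ Icc (min 0 s) (max 0 s) := ⟨hu.1.le, hu.2⟩
        exact ⟨(le_min h0N.1 hsN.1).trans hu'.1, hu'.2.trans (max_le h0N.2 hsN.2)⟩
    rw [Real.norm_eq_abs, sub_zero] at h
    refine h.trans (mul_le_mul_of_nonneg_left ?_ (by positivity))
    exact abs_le.2 ⟨by linarith [hsN.1], hsN.2⟩
  -- conclusion
  have hxs : |x s - x₀ s| < r := by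
    have := hp1 s hsN; rw [Real.dist_eq, abs_sub_comm] at this; exact this
  have hq : |q - q₀| < ε / 3 := by rwa [← Real.dist_eq]
  simp only [goodDriving, drivingOfAngle]
  calc |q - (∫ u in (0 : ℝ)..s, Real.cot (x u / 2)) + x s - (q₀ - (∫ u in (0 : ℝ)..s, Real.cot (x₀ u / 2)) + x₀ s)|
      = |(q - q₀) - ((∫ u in (0 : ℝ)..s, Real.cot (x u / 2)) - ∫ u in (0 : ℝ)..s, Real.cot (x₀ u / 2)) + (x s - x₀ s)| := by
        ring_nf
    _ ≤ |q - q₀| + |(∫ u in (0 : ℝ)..s, Real.cot (x u / 2)) - ∫ u in (0 : ℝ)..s, Real.cot (x₀ u / 2)| + |x s - x₀ s| := by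
        refine (abs_add_le _ _).trans (add_le_add (abs_sub _ _) le_rfl)
    _ ≤ ε / 3 + Lc * r * N + r := by linarith [hint]
    _ ≤ ε := by nlinarith [hrε, hrpos, hLcpos, N.cast_nonneg (α := ℝ)]

/-- Continuity of the driving angle at a fixed time in the good parameter. [folklore] -/
theorem continuous_goodDriving_apply (s : ℝ) : Continuous fun p : GoodParam ↦ goodDriving p s := by
  refine continuous_iff_continuousAt.2 fun p₀ ↦ Metric.tendsto_nhds.2 fun ε hε ↦ ?_
  filter_upwards [eventually_abs_goodDriving_sub_le s s p₀ (ε / 2) (by positivity)] with p hp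
  rw [Real.dist_eq]
  exact (hp s ⟨le_rfl, le_rfl⟩).trans_lt (by linarith)

/-! ### Measurability of the inverse maps and of the tip -/

/-- **`(X, q₀) ↦ F_t^{λ}(R e^{iλ_t})` is Borel measurable on the good parameters.**
[cite: RohdeSchramm2005, §3] -/
theorem measurable_invMap_goodDriving (t : ℝ) {R : ℝ} (hR : 1 < R) :
    Measurable fun p : GoodParam ↦ invMap (goodDriving p) t ((R : ℂ) * Complex.exp ((goodDriving p t : ℝ) * I)) := by
  have hW : Continuous fun p : GoodParam ↦ (R : ℂ) * Complex.exp ((goodDriving p t : ℝ) * I) :=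
    continuous_const.mul (Complex.continuous_exp.comp
      ((Complex.continuous_ofReal.comp (continuous_goodDriving_apply t)).mul continuous_const))
  have hW1 : ∀ p : GoodParam, 1 < ‖(R : ℂ) * Complex.exp ((goodDriving p t : ℝ) * I)‖ := fun p ↦ by
    rw [norm_mul, Complex.norm_exp_ofReal_mul_I, mul_one, Complex.norm_real, Real.norm_eq_abs,
      abs_of_pos (by linarith)]
    exact hR
  exact measurable_invMap_param continuous_goodDriving
    (fun a b p₀ ε hε ↦ eventually_abs_goodDriving_sub_le a b p₀ ε hε) hW hW1 t

open scoped Classical in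
/-- The same, extended by `0` to all parameters (a `dite` on the good set). [folklore] -/
theorem measurable_invMap_drivingOfAngle (t : ℝ) {R : ℝ} (hR : 1 < R) :
    Measurable fun p : C(ℝ, ℝ) × ℝ ↦ if h : p.1 ∈ goodAnglePaths then
      invMap (goodDriving ⟨p, h⟩) t ((R : ℂ) * Complex.exp ((goodDriving ⟨p, h⟩ t : ℝ) * I)) else 0 := by
  classical
  exact Measurable.dite (s := {p : C(ℝ, ℝ) × ℝ | p.1 ∈ goodAnglePaths})
    (measurable_invMap_goodDriving t hR) (g := fun _ ↦ (0 : ℂ)) measurable_const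
    (measurable_fst measurableSet_goodAnglePaths)

/-- The approach radii `R_k = 1 + 1/(k+1) ↓ 1`. [folklore] -/
def approachSeq (k : ℕ) : ℝ := 1 + 1 / ((k : ℝ) + 1)

/-- `R_k > 1`. [folklore] -/
theorem one_lt_approachSeq (k : ℕ) : 1 < approachSeq k := by
  rw [approachSeq]; have : (0 : ℝ) < 1 / ((k : ℝ) + 1) := by positivity
  linarith

/-- `R_k → 1` from the right. [folklore] -/
theorem tendsto_approachSeq : Tendsto approachSeq atTop (𝓝[>] 1) := by
  refine tendsto_nhdsWithin_iff.2 ⟨?_, Eventually.of_forall fun k ↦ one_lt_approachSeq k⟩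
  have h : Tendsto (fun k : ℕ ↦ 1 / ((k : ℝ) + 1)) atTop (𝓝 0) := tendsto_one_div_add_atTop_nhds_zero_nat
  have h2 : approachSeq = fun k : ℕ ↦ 1 + 1 / ((k : ℝ) + 1) := rfl
  rw [h2]
  simpa using h.const_add 1

/-- **The tip along the sequence `R_k`**: the limit of `F_t(R_k e^{iλ_t})` if it exists, else `0`.
[cite: Lawler2005, §6.6] -/
def WholePlaneLoewner.tipSeq (lam : ℝ → ℝ) (t : ℝ) : ℂ := by
  classical
  exact if h : ∃ c : ℂ, Tendsto (fun k : ℕ ↦ invMap lam t ((approachSeq k : ℂ) * Complex.exp ((lam t : ℝ) * I)))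
    atTop (𝓝 c) then h.choose else 0

/-- **When the tip limit exists, the sequential tip is the tip limit.** [folklore] -/
theorem WholePlaneLoewner.tipSeq_eq_of_tendsto {lam : ℝ → ℝ} {t : ℝ} {c : ℂ}
    (h : Tendsto (fun R : ℝ ↦ invMap lam t ((R : ℂ) * Complex.exp ((lam t : ℝ) * I))) (𝓝[>] 1) (𝓝 c)) :
    WholePlaneLoewner.tipSeq lam t = c := by
  classical
  have hseq : Tendsto (fun k : ℕ ↦ invMap lam t ((approachSeq k : ℂ) * Complex.exp ((lam t : ℝ) * I)))
      atTop (𝓝 c) := h.comp tendsto_approachSeq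
  have hex : ∃ c : ℂ, Tendsto (fun k : ℕ ↦ invMap lam t ((approachSeq k : ℂ) * Complex.exp ((lam t : ℝ) * I)))
      atTop (𝓝 c) := ⟨c, hseq⟩
  rw [WholePlaneLoewner.tipSeq, dif_pos hex]
  exact tendsto_nhds_unique hex.choose_spec hseq

/-- **The whole-plane SLE_κ(ρ) curve as a function of the angle path and the phase**:
the sequential tip of the driving angle `drivingOfAngle q₀ X`, on the good set (else `0`).
[cite: MillerSheffield2013, Prop. 2.5] -/
def wpCurve (p : C(ℝ, ℝ) × ℝ) (t : ℝ) : ℂ := by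
  classical
  exact if p.1 ∈ goodAnglePaths then WholePlaneLoewner.tipSeq (drivingOfAngle p.2 p.1) t else 0

/-- On the good set, when the tip limit exists, the curve is the tip. [folklore] -/
theorem wpCurve_eq_tip {p : C(ℝ, ℝ) × ℝ} (hp : p.1 ∈ goodAnglePaths) {t : ℝ}
    (h : Tendsto (fun R : ℝ ↦ invMap (drivingOfAngle p.2 p.1) t
      ((R : ℂ) * Complex.exp ((drivingOfAngle p.2 p.1 t : ℝ) * I))) (𝓝[>] 1)
      (𝓝 (WholePlaneLoewner.tip (drivingOfAngle p.2 p.1) t))) :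
    wpCurve p t = WholePlaneLoewner.tip (drivingOfAngle p.2 p.1) t := by
  classical
  simp only [wpCurve, if_pos hp]
  exact WholePlaneLoewner.tipSeq_eq_of_tendsto h

/-- Equality of the two `dite`-limits along equal sequences. [folklore] -/
theorem dite_tendsto_congr {u v : ℕ → ℂ} (h : u = v) :
    (by classical exact if h : ∃ c : ℂ, Tendsto u atTop (𝓝 c) then h.choose else (0 : ℂ)) =
      (by classical exact if h : ∃ c : ℂ, Tendsto v atTop (𝓝 c) then h.choose else (0 : ℂ)) := by
  subst h; rfl

/-- **Measurability of the curve marginals**: `(X, q₀) ↦ wpCurve (X, q₀) t` is Borel measurable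
(the set where the measurable sequence `F_t(R_k e^{iλ_t})` converges is measurable,
`measurableSet_exists_tendsto`, and the limit is measurable, `measurable_of_tendsto_metrizable`).
[cite: RohdeSchramm2005, §3] -/
theorem measurable_wpCurve (t : ℝ) : Measurable fun p : C(ℝ, ℝ) × ℝ ↦ wpCurve p t := by
  classical
  -- the measurable sequence
  set f : ℕ → C(ℝ, ℝ) × ℝ → ℂ := fun k p ↦ if h : p.1 ∈ goodAnglePaths then
    invMap (goodDriving ⟨p, h⟩) t ((approachSeq k : ℂ) * Complex.exp ((goodDriving ⟨p, h⟩ t : ℝ) * I))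
    else 0 with hf
  have hfm : ∀ k, Measurable (f k) := fun k ↦ measurable_invMap_drivingOfAngle t (one_lt_approachSeq k)
  -- the convergence set
  set E : Set (C(ℝ, ℝ) × ℝ) := {p | ∃ c, Tendsto (fun k ↦ f k p) atTop (𝓝 c)} with hE
  have hEm : MeasurableSet E := measurableSet_exists_tendsto hfm
  -- the limit function
  set g : C(ℝ, ℝ) × ℝ → ℂ := fun p ↦ if h : ∃ c, Tendsto (fun k ↦ f k p) atTop (𝓝 c) then h.choose else 0
    with hg
  have hgm : Measurable g := by
    have hlim : Tendsto (fun k p ↦ E.indicator (f k) p) atTop (𝓝 g) := by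
      refine tendsto_pi_nhds.2 fun p ↦ ?_
      by_cases hp : ∃ c, Tendsto (fun k ↦ f k p) atTop (𝓝 c)
      · have hpE : p ∈ E := hp
        simp only [indicator_of_mem hpE, hg, dif_pos hp]
        exact hp.choose_spec
      · have hpE : p ∉ E := hp
        simp only [indicator_of_notMem hpE, hg, dif_neg hp]
        exact tendsto_const_nhds
    exact measurable_of_tendsto_metrizable (fun k ↦ (hfm k).indicator hEm) hlim
  -- identification with `wpCurve`
  have heq : (fun p : C(ℝ, ℝ) × ℝ ↦ wpCurve p t) = g := by
    funext p
    by_cases hp : p.1 ∈ goodAnglePaths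
    · have hfp : (fun k ↦ invMap (drivingOfAngle p.2 p.1) t
          ((approachSeq k : ℂ) * Complex.exp ((drivingOfAngle p.2 p.1 t : ℝ) * I))) = fun k ↦ f k p := by
        funext k; simp only [hf, dif_pos hp]; rfl
      have h1 : wpCurve p t = WholePlaneLoewner.tipSeq (drivingOfAngle p.2 p.1) t := by
        simp only [wpCurve, if_pos hp]
      rw [h1]
      exact dite_tendsto_congr hfp
    · have hk : ∀ k, f k p = 0 := fun k ↦ by simp only [hf, dif_neg hp]
      have h2 : Tendsto (fun k ↦ f k p) atTop (𝓝 0) := tendsto_const_nhds.congr fun k ↦ (hk k).symm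
      have hex : ∃ c, Tendsto (fun k ↦ f k p) atTop (𝓝 c) := ⟨0, h2⟩
      have h1 : Tendsto (fun k ↦ f k p) atTop (𝓝 hex.choose) := hex.choose_spec
      have hgp : g p = hex.choose := by simp only [hg, dif_pos hex]
      have hwp : wpCurve p t = 0 := by simp only [wpCurve, if_neg hp]
      rw [hgp, hwp]
      exact tendsto_nhds_unique h2 h1
  rw [heq]
  exact hgm

end Literature.Probability.RandomPlanarGeometry
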